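import Literature.NumberTheory.ComplexMultiplication.CMOrderWeakEquivalenceSingularPrimes
import HarnessLib

/-!
# The over-order `T = R + 𝔭ⁿ𝒪` of an order at a maximal ideal (MARSEGLIA 2025 LEMMA 4.1 (1)): for `n` with
# `(𝔭ⁿ𝒪)_𝔭 ⊆ R_𝔭`, `T` is an over-order with `T_𝔭 = R_𝔭` and `T_𝔮 = 𝒪_𝔮` at every other maximal ideal `𝔮`

Family `hodge`, lane `lit-hodgefound` (Track 2 foundations library; seat p15, row g26-#11), topic
`Literature/NumberTheory/ComplexMultiplication`, namespaces `Literature.NumberTheory.ComplexMultiplication.NumberRing`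
(§1: plumbing for any domain `R` with fraction field `K`) and `…EndOrder` (§2: the order `𝔯 = endOrder ρ ⊆ 𝒪 = 𝓞_K`
of the series).  THEOREMS ONLY: no definition, no instance, no named fact (net Literature debt `0`).  Vocabulary:
`FractionalIdeal (endOrder ρ)⁰ K`; the maximal order is an idempotent `M = MM ≠ 0` with
`↑M = (algebraMap (𝓞 K) K).range` (as in `CMOrderTraceDualInverseDifferent` / `CMOrderConductorDifferentFormula`);
`T = R + 𝔭ⁿ𝒪` is the fractional ideal `1 + ↑(𝔭 ^ n) * M` (no new definition); `R_𝔭 = Localization.subalgebra.ofField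
K 𝔭.primeCompl _`, `I_𝔭 = span R_𝔭 ↑I`; the conductor is `EndOrder.conductorIdeal ρ = 𝔣` and `𝔣_(𝔭)` its
`𝔭`-primary component `comap (map 𝔣)` through `Localization.AtPrime 𝔭` (`CMOrderPrimaryDecomposition`).

## Source, VERBATIM

S. Marseglia, *Local isomorphism classes of fractional ideals of orders in étale algebras*, J. Algebra 673 (2025)
77–102 [Marseglia2025LocalIsomorphism] (arXiv:2311.18571, held `paper:arxiv-2311.18571`, chunk p0008):
"For every maximal ideal `𝔭` of `R`, let `n_𝔭` be a positive integer such that `(𝔭^{n_𝔭}𝒪)_𝔭 ⊆ R_𝔭`. For every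
`N ≥ n_𝔭`, we have an equality `R + 𝔭^{n_𝔭}𝒪 = R + 𝔭^N𝒪`. Concretely, one can take `n_𝔭 = v_p([𝒪:R])`, where `p` is
the contraction of `𝔭` in `Z` and `v_p` is the `p`-adic valuation.
Lemma 4.1. Put `T = R + 𝔭^{n_𝔭}𝒪`. Then: (1) Locally at `𝔭`, we have `R_𝔭 = T_𝔭`, while, for every maximal ideal `𝔮`
of `R` different from `𝔭`, we have `T_𝔮 = 𝒪_𝔮`. (2) `𝔭T` is a maximal ideal of `T`. (3) `𝔭` and `𝔭T` have isomorphic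
residue fields `R/𝔭 ≃ T/𝔭T`. (4) We have a canonical isomorphism `T_𝔭 ≃ T_{𝔭T}`. (5) If `𝔭` is non-invertible then
the unique non-invertible maximal ideal of `T` is `𝔭T`.  Proof. Part (1) is clear from the definition of `T`. …"

## What is formalised (part (1) and «`T` is an overorder»; parts (2)–(5) speak of `T` as a ring with its own
## spectrum and are not stated here)

* §1 (any domain): `NumberRing.add_le_of_le_of_le`, `le_add_right'`, **`span_coe_add`** (`(I+J)_𝔭 = I_𝔭 + J_𝔭`),
  **`span_coe_coeIdeal_eq_span_one_of_not_le'`** (`𝔞_𝔮 = R_𝔮` for an ideal `𝔞 ⊄ 𝔮`).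
* §2 (`𝔯 = endOrder ρ`): **`coeIdeal_conductorIdeal_mul_le_one`** (`𝔣𝒪 ⊆ R`), **`exists_span_coe_pow_mul_le`** (an
  `n_𝔭` with `(𝔭ⁿ𝒪)_𝔭 ⊆ R_𝔭` exists: `𝔭ⁿ ⊆ 𝔣_(𝔭)`), **`one_add_mul_mul_self_eq`** (`TT = T`),
  **`span_coe_one_add_mul_eq_span_one`** (`T_𝔭 = R_𝔭`), **`span_coe_one_add_mul_eq_of_ne`** (`T_𝔮 = 𝒪_𝔮` for
  maximal `𝔮 ≠ 𝔭`, any `n ≥ 1`), **`exists_overorder_span_coe_eq`** (LEMMA 4.1 (1) packaged: an over-order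
  `R ⊆ T ⊆ 𝒪` with `T_𝔭 = R_𝔭` and `T_𝔮 = 𝒪_𝔮` for all maximal `𝔮 ≠ 𝔭`).
-/

open scoped nonZeroDivisors NumberField
open Module FractionalIdeal NumberField

namespace Literature.NumberTheory.ComplexMultiplication

namespace NumberRing

/-! ## §1 Plumbing: sums of fractional ideals and their local components -/

section AnyDomain

variable {R : Type*} [CommRing R] [IsDomain R] {K : Type*} [Field K] [Algebra R K] [IsFractionRing R K]

omit [IsDomain R] [IsFractionRing R K] in
/-- `I ⊆ L`, `J ⊆ L ⟹ I + J ⊆ L` (the sum of fractional ideals is their supremum).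
[cite: Marseglia2025LocalIsomorphism, §4 («`T = R + 𝔭^{n_𝔭}𝒪`»), p. 8] -/
theorem add_le_of_le_of_le {I J L : FractionalIdeal R⁰ K} (hI : I ≤ L) (hJ : J ≤ L) : I + J ≤ L := fun x hx ↦ by
  rw [← mem_coe, coe_add, Submodule.add_eq_sup, Submodule.mem_sup] at hx
  obtain ⟨y, hy, z, hz, rfl⟩ := hx
  exact Submodule.add_mem (L : Submodule R K) (hI hy) (hJ hz)

omit [IsDomain R] [IsFractionRing R K] in
/-- `I ⊆ I + J`. [cite: Marseglia2025LocalIsomorphism, §4 («`R ⊆ T = R + 𝔭^{n_𝔭}𝒪`»), p. 8] -/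
theorem le_add_right' (I J : FractionalIdeal R⁰ K) : I ≤ I + J := fun x hx ↦ by
  rw [← mem_coe, coe_add, Submodule.add_eq_sup]
  exact Submodule.mem_sup_left hx

omit [IsDomain R] [IsFractionRing R K] in
/-- **`(I + J)_𝔭 = I_𝔭 + J_𝔭`**: local components are additive («`(I+J)_𝔭 = I_𝔭 + J_𝔭`»).
[cite: Marseglia2025LocalIsomorphism, §2 (the displayed identities for `(I+J)_𝔭`), p. 5] -/
theorem span_coe_add (A : Subalgebra R K) (I J : FractionalIdeal R⁰ K) :
    Submodule.span A ((I + J : FractionalIdeal R⁰ K) : Set K) =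
      Submodule.span A (I : Set K) ⊔ Submodule.span A (J : Set K) := by
  rw [← Submodule.span_union]
  refine le_antisymm (Submodule.span_le.2 fun x hx ↦ ?_) (Submodule.span_mono (Set.union_subset
    (fun x hx ↦ le_add_right' I J hx) (fun x hx ↦ (add_comm J I ▸ le_add_right' J I) hx)))
  have hx' : x ∈ ((I + J : FractionalIdeal R⁰ K) : Submodule R K) := hx
  rw [coe_add, Submodule.add_eq_sup, Submodule.mem_sup] at hx'
  obtain ⟨y, hy, z, hz, rfl⟩ := hx'
  exact add_mem (Submodule.subset_span (Set.mem_union_left _ hy)) (Submodule.subset_span (Set.mem_union_right _ hz))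

/-- **`𝔞_𝔮 = R_𝔮` for an ideal `𝔞 ⊄ 𝔮`** (some `u ∈ 𝔞 ∖ 𝔮` is a unit of `R_𝔮`; used for `(𝔭ⁿ)_𝔮 = R_𝔮`, `𝔮 ≠ 𝔭`).
[cite: Marseglia2025LocalIsomorphism, §4 Lemma 4.1 (1) («for every maximal ideal `𝔮` of `R` different from `𝔭`, we
have `T_𝔮 = 𝒪_𝔮`»), p. 8] [cite: Stevenhagen2008NumberRings, §5 (local components, «`I_𝔭 = R_𝔭` if `𝔭` does not
divide `I`»), p. 218] -/
theorem span_coe_coeIdeal_eq_span_one_of_not_le' {𝔞 𝔮 : Ideal R} [h𝔮 : 𝔮.IsPrime] (h : ¬ 𝔞 ≤ 𝔮) :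
    Submodule.span (Localization.subalgebra.ofField K 𝔮.primeCompl 𝔮.primeCompl_le_nonZeroDivisors)
        ((𝔞 : FractionalIdeal R⁰ K) : Set K) =
      Submodule.span (Localization.subalgebra.ofField K 𝔮.primeCompl 𝔮.primeCompl_le_nonZeroDivisors) {1} := by
  obtain ⟨u, hu𝔞, hu𝔮⟩ := Set.not_subset.1 h
  refine le_antisymm ?_ ?_
  · rw [← span_coe_one (Localization.subalgebra.ofField K 𝔮.primeCompl 𝔮.primeCompl_le_nonZeroDivisors)]
    exact Submodule.span_mono fun x hx ↦ coeIdeal_le_one hx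
  · rw [← span_singleton_algebraMap_eq_span_one (K := K) hu𝔮]
    exact Submodule.span_mono (Set.singleton_subset_iff.2 ((mem_coeIdeal R⁰).2 ⟨u, hu𝔞, rfl⟩))

end AnyDomain

end NumberRing

/-! ## §2 The order `𝔯 = endOrder ρ`: `T = R + 𝔭ⁿ𝒪` -/

namespace EndOrder

variable {K : Type} [Field K] [NumberField K]
variable {ι : Type} [Fintype ι] [DecidableEq ι] [Nonempty ι] {ρ : K →ₐ[ℚ] Matrix ι ι ℚ}
variable [IsFractionRing (endOrder ρ) K]

omit [IsFractionRing (endOrder ρ) K] in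
/-- **`𝔣·𝒪 ⊆ R`**: the conductor multiplies the maximal order into the order (`↑M = 𝓞_K`).
[cite: Marseglia2025LocalIsomorphism, §2 («the conductor `𝔣 = (R:𝒪)`»), p. 5; §4 (choice of `n_𝔭`), p. 8]
[cite: Stevenhagen2008NumberRings, §6 («`𝔣_R = {x ∈ 𝒪 : x𝒪 ⊂ R}`»), p. 224] -/
theorem coeIdeal_conductorIdeal_mul_le_one {M : FractionalIdeal (endOrder ρ)⁰ K}
    (hMO : (M : Set K) = (algebraMap (𝓞 K) K).range) :
    (conductorIdeal ρ : FractionalIdeal (endOrder ρ)⁰ K) * M ≤ 1 := by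
  refine FractionalIdeal.mul_le.2 fun x hx y hy ↦ ?_
  obtain ⟨r, hr, rfl⟩ := (mem_coeIdeal (endOrder ρ)⁰).1 hx
  obtain ⟨o, rfl⟩ : y ∈ (algebraMap (𝓞 K) K).range := by rw [← SetLike.mem_coe, ← hMO]; exact hy
  exact (mem_one_iff _).2 ⟨⟨(r : K) * algebraMap (𝓞 K) K o, (mem_conductorIdeal_iff ρ).1 hr o⟩, rfl⟩

/-- **The exponent `n_𝔭`: some `n` has `(𝔭ⁿ𝒪)_𝔭 ⊆ R_𝔭`** — take `𝔭ⁿ ⊆ 𝔣_(𝔭)` (the `𝔭`-primary component of the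
conductor, `CMOrderPrimaryDecomposition.exists_pow_le_comap_map`); then `(𝔭ⁿ𝒪)_𝔭 ⊆ (𝔣_(𝔭))_𝔭·𝒪 = 𝔣_𝔭𝒪 = (𝔣𝒪)_𝔭 ⊆ R_𝔭`.
[cite: Marseglia2025LocalIsomorphism, §4 («let `n_𝔭` be a positive integer such that `(𝔭^{n_𝔭}𝒪)_𝔭 ⊆ R_𝔭` … one can
take `n_𝔭 = v_p([𝒪:R])`»), p. 8] -/
theorem exists_span_coe_pow_mul_le {M : FractionalIdeal (endOrder ρ)⁰ K}
    (hMO : (M : Set K) = (algebraMap (𝓞 K) K).range) (𝔭 : Ideal (endOrder ρ)) [𝔭.IsMaximal] :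
    ∃ n : ℕ, 0 < n ∧
      Submodule.span (Localization.subalgebra.ofField K 𝔭.primeCompl 𝔭.primeCompl_le_nonZeroDivisors)
          ((((𝔭 ^ n : Ideal (endOrder ρ)) : FractionalIdeal (endOrder ρ)⁰ K) * M :
            FractionalIdeal (endOrder ρ)⁰ K) : Set K) ≤
        Submodule.span (Localization.subalgebra.ofField K 𝔭.primeCompl 𝔭.primeCompl_le_nonZeroDivisors) {1} := by
  haveI := CMTypeLattice.isNoetherianRing_endOrder ρ
  haveI := CMTypeLattice.dimensionLEOne_endOrder ρ
  set A := Localization.subalgebra.ofField K 𝔭.primeCompl 𝔭.primeCompl_le_nonZeroDivisors with hA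
  obtain ⟨n, hn⟩ := NumberRing.exists_pow_le_comap_map (conductorIdeal_ne_bot ρ) 𝔭
  -- `𝔭ⁿ⁺¹ ⊆ 𝔭ⁿ ⊆ 𝔣_(𝔭)` (so that the exponent is positive)
  refine ⟨n + 1, n.succ_pos, ?_⟩
  have hn' : 𝔭 ^ (n + 1) ≤ ((conductorIdeal ρ).map (algebraMap (endOrder ρ) (Localization.AtPrime 𝔭))).comap
      (algebraMap (endOrder ρ) (Localization.AtPrime 𝔭)) := (Ideal.pow_le_pow_right n.le_succ).trans hn
  calc Submodule.span A ((((𝔭 ^ (n + 1) : Ideal (endOrder ρ)) : FractionalIdeal (endOrder ρ)⁰ K) * M :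
          FractionalIdeal (endOrder ρ)⁰ K) : Set K)
      = Submodule.span A (((𝔭 ^ (n + 1) : Ideal (endOrder ρ)) : FractionalIdeal (endOrder ρ)⁰ K) : Set K) *
          Submodule.span A (M : Set K) := NumberRing.span_coe_mul A _ _
    _ ≤ Submodule.span A (((((conductorIdeal ρ).map (algebraMap (endOrder ρ) (Localization.AtPrime 𝔭))).comap
          (algebraMap (endOrder ρ) (Localization.AtPrime 𝔭)) : Ideal (endOrder ρ)) :
            FractionalIdeal (endOrder ρ)⁰ K) : Set K) * Submodule.span A (M : Set K) :=
        mul_le_mul' (Submodule.span_mono fun x hx ↦ (coeIdeal_le_coeIdeal K).2 hn' hx) le_rfl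
    _ = Submodule.span A ((conductorIdeal ρ : FractionalIdeal (endOrder ρ)⁰ K) : Set K) *
          Submodule.span A (M : Set K) := by rw [NumberRing.span_coe_comap_map_eq]
    _ = Submodule.span A ((((conductorIdeal ρ : FractionalIdeal (endOrder ρ)⁰ K) * M :
          FractionalIdeal (endOrder ρ)⁰ K)) : Set K) := (NumberRing.span_coe_mul A _ _).symm
    _ ≤ Submodule.span A (((1 : FractionalIdeal (endOrder ρ)⁰ K)) : Set K) :=
        Submodule.span_mono fun x hx ↦ coeIdeal_conductorIdeal_mul_le_one hMO hx
    _ = Submodule.span A {1} := NumberRing.span_coe_one A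

omit [Nonempty ι] in
/-- **`T = R + 𝔭ⁿ𝒪` is an over-order: `TT = T`** (`𝔭ⁿ𝒪·𝔭ⁿ𝒪 = 𝔭²ⁿ𝒪 ⊆ 𝔭ⁿ𝒪`, `R·𝔭ⁿ𝒪 ⊆ 𝔭ⁿ𝒪`, `1 ∈ T`; any ideal `𝔞`
in place of `𝔭ⁿ`). [cite: Marseglia2025LocalIsomorphism, §4 Lemma 4.1 («Put `T = R + 𝔭^{n_𝔭}𝒪`», an overorder of
`R`), p. 8] [cite: Marseglia2019, §2 Lemma 2.2 (over-orders are the idempotent fractional ideals), p. 4] -/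
theorem one_add_mul_mul_self_eq {M : FractionalIdeal (endOrder ρ)⁰ K} (hMM : M * M = M) (𝔞 : Ideal (endOrder ρ)) :
    (1 + (𝔞 : FractionalIdeal (endOrder ρ)⁰ K) * M) * (1 + (𝔞 : FractionalIdeal (endOrder ρ)⁰ K) * M) =
      1 + (𝔞 : FractionalIdeal (endOrder ρ)⁰ K) * M := by
  set a : FractionalIdeal (endOrder ρ)⁰ K := (𝔞 : FractionalIdeal (endOrder ρ)⁰ K) * M with ha
  have h1 : (1 : K) ∈ 1 + a := NumberRing.le_add_right' 1 a (one_mem_one _)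
  refine mul_self_eq_of_one_mem_of_mul_self_le h1 ?_
  -- `(1 + a)(1 + a) = (1 + a) + (a + aa)` and `aa = 𝔞²·M² ⊆ 𝔞M = a`
  have haa : a * a ≤ a := by
    rw [ha, mul_mul_mul_comm, hMM, ← coeIdeal_mul]
    exact mul_le_mul' ((coeIdeal_le_coeIdeal K).2 Ideal.mul_le_right) le_rfl
  rw [add_mul, one_mul, mul_add, mul_one]
  exact NumberRing.add_le_of_le_of_le le_rfl
    (NumberRing.add_le_of_le_of_le (by rw [add_comm]; exact NumberRing.le_add_right' a 1)
      (haa.trans (by rw [add_comm]; exact NumberRing.le_add_right' a 1)))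

omit [Nonempty ι] in
/-- **LEMMA 4.1 (1), at `𝔭`: `T_𝔭 = R_𝔭`** for `T = R + 𝔭ⁿ𝒪` as soon as `(𝔭ⁿ𝒪)_𝔭 ⊆ R_𝔭` («Locally at `𝔭`, we have
`R_𝔭 = T_𝔭`»; any `N` in place of `𝔭ⁿ𝒪`). [cite: Marseglia2025LocalIsomorphism, §4 Lemma 4.1 (1), p. 8] -/
theorem span_coe_one_add_eq_span_one {N : FractionalIdeal (endOrder ρ)⁰ K} (𝔭 : Ideal (endOrder ρ)) [𝔭.IsPrime]
    (hN : Submodule.span (Localization.subalgebra.ofField K 𝔭.primeCompl 𝔭.primeCompl_le_nonZeroDivisors)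
        (N : Set K) ≤
      Submodule.span (Localization.subalgebra.ofField K 𝔭.primeCompl 𝔭.primeCompl_le_nonZeroDivisors) {1}) :
    Submodule.span (Localization.subalgebra.ofField K 𝔭.primeCompl 𝔭.primeCompl_le_nonZeroDivisors)
        ((1 + N : FractionalIdeal (endOrder ρ)⁰ K) : Set K) =
      Submodule.span (Localization.subalgebra.ofField K 𝔭.primeCompl 𝔭.primeCompl_le_nonZeroDivisors) {1} := by
  rw [NumberRing.span_coe_add, NumberRing.span_coe_one, sup_eq_left.2 hN]

omit [Nonempty ι] in
/-- **LEMMA 4.1 (1), away from `𝔭`: `T_𝔮 = 𝒪_𝔮` for every prime `𝔮 ⊉ 𝔭ⁿ`** (e.g. every maximal `𝔮 ≠ 𝔭`), for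
`T = R + 𝔭ⁿ𝒪` with `↑M = 𝒪 ∋ 1` («for every maximal ideal `𝔮` of `R` different from `𝔭`, we have `T_𝔮 = 𝒪_𝔮`»:
`(𝔭ⁿ)_𝔮 = R_𝔮`). [cite: Marseglia2025LocalIsomorphism, §4 Lemma 4.1 (1), p. 8] -/
theorem span_coe_one_add_mul_eq_of_not_le {M : FractionalIdeal (endOrder ρ)⁰ K} (h1 : (1 : K) ∈ M)
    {𝔞 𝔮 : Ideal (endOrder ρ)} [𝔮.IsPrime] (h : ¬ 𝔞 ≤ 𝔮) :
    Submodule.span (Localization.subalgebra.ofField K 𝔮.primeCompl 𝔮.primeCompl_le_nonZeroDivisors)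
        ((1 + (𝔞 : FractionalIdeal (endOrder ρ)⁰ K) * M : FractionalIdeal (endOrder ρ)⁰ K) : Set K) =
      Submodule.span (Localization.subalgebra.ofField K 𝔮.primeCompl 𝔮.primeCompl_le_nonZeroDivisors)
        (M : Set K) := by
  set A := Localization.subalgebra.ofField K 𝔮.primeCompl 𝔮.primeCompl_le_nonZeroDivisors with hA
  have hM1 : Submodule.span A {1} ≤ Submodule.span A (M : Set K) :=
    Submodule.span_mono (Set.singleton_subset_iff.2 h1)
  rw [NumberRing.span_coe_add, NumberRing.span_coe_one, NumberRing.span_coe_mul,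
    NumberRing.span_coe_coeIdeal_eq_span_one_of_not_le' h, ← Submodule.one_eq_span, one_mul, Submodule.one_eq_span,
    sup_eq_right.2 hM1]

/-- **LEMMA 4.1 (1), packaged: for every maximal ideal `𝔭` of the order `𝔯 = endOrder ρ ⊆ 𝒪` there is an over-order
`T` (`TT = T`, `R ⊆ T ⊆ 𝒪`) — namely `T = R + 𝔭ⁿ𝒪` for the `n = n_𝔭` of `exists_span_coe_pow_mul_le` — with
`T_𝔭 = R_𝔭` and `T_𝔮 = 𝒪_𝔮` for every maximal `𝔮 ≠ 𝔭`.** [cite: Marseglia2025LocalIsomorphism, §4 Lemma 4.1 (1),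
p. 8] -/
theorem exists_overorder_span_coe_eq {M : FractionalIdeal (endOrder ρ)⁰ K} (hMM : M * M = M) (hM0 : M ≠ 0)
    (hMO : (M : Set K) = (algebraMap (𝓞 K) K).range) (𝔭 : MaximalSpectrum (endOrder ρ)) :
    ∃ T : FractionalIdeal (endOrder ρ)⁰ K, T * T = T ∧ T ≠ 0 ∧ 1 ≤ T ∧ T ≤ M ∧
      Submodule.span (Localization.subalgebra.ofField K 𝔭.asIdeal.primeCompl
          𝔭.asIdeal.primeCompl_le_nonZeroDivisors) (T : Set K) =
        Submodule.span (Localization.subalgebra.ofField K 𝔭.asIdeal.primeCompl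
          𝔭.asIdeal.primeCompl_le_nonZeroDivisors) {1} ∧
      ∀ 𝔮 : MaximalSpectrum (endOrder ρ), 𝔮 ≠ 𝔭 →
        Submodule.span (Localization.subalgebra.ofField K 𝔮.asIdeal.primeCompl
            𝔮.asIdeal.primeCompl_le_nonZeroDivisors) (T : Set K) =
          Submodule.span (Localization.subalgebra.ofField K 𝔮.asIdeal.primeCompl
            𝔮.asIdeal.primeCompl_le_nonZeroDivisors) (M : Set K) := by
  haveI := 𝔭.isMaximal
  obtain ⟨n, hn0, hn⟩ := exists_span_coe_pow_mul_le hMO 𝔭.asIdeal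
  have h1M : 1 ≤ M := one_le_of_mul_self_eq hMM hM0
  have hM1 : (1 : K) ∈ M := FractionalIdeal.one_le.1 h1M
  refine ⟨1 + ((𝔭.asIdeal ^ n : Ideal (endOrder ρ)) : FractionalIdeal (endOrder ρ)⁰ K) * M,
    one_add_mul_mul_self_eq hMM _, ?_, NumberRing.le_add_right' _ _, ?_, ?_, fun 𝔮 h𝔮 ↦ ?_⟩
  · exact fun h ↦ one_ne_zero (le_bot_iff.1 (le_of_le_of_eq (NumberRing.le_add_right' (1 : FractionalIdeal
      (endOrder ρ)⁰ K) _) h))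
  · refine NumberRing.add_le_of_le_of_le h1M ?_
    calc ((𝔭.asIdeal ^ n : Ideal (endOrder ρ)) : FractionalIdeal (endOrder ρ)⁰ K) * M ≤ 1 * M :=
          mul_le_mul' coeIdeal_le_one le_rfl
      _ = M := one_mul M
  · haveI := 𝔭.isMaximal.isPrime
    exact span_coe_one_add_eq_span_one 𝔭.asIdeal hn
  · haveI := 𝔮.isMaximal.isPrime
    refine span_coe_one_add_mul_eq_of_not_le hM1 fun hle ↦ h𝔮 ?_
    -- `𝔭ⁿ ⊆ 𝔮` forces `𝔭 ⊆ 𝔮`, hence `𝔮 = 𝔭`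
    have h𝔭𝔮 : 𝔭.asIdeal ≤ 𝔮.asIdeal := (𝔮.isMaximal.isPrime.pow_le_iff hn0.ne').1 hle
    exact MaximalSpectrum.ext (𝔭.isMaximal.eq_of_le 𝔮.isMaximal.ne_top h𝔭𝔮).symm

end EndOrder

end Literature.NumberTheory.ComplexMultiplication
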